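import Summits.ResolutionOfSingularities.ResolutionOfSingularities.Theses.TropicalLinks
import Literature.AlgebraicGeometry.Tropical.InitialIdeal

/-!
# Crux `InductiveStep` (stmt-ResolutionOfSingularities-17233) — junk guards: what is (not) load-bearing
# in the typing of `SchonAt`

Route `ResolutionOfSingularities/TropicalLinks`, crux `InductiveStep` (`∀ p prime, ∀ d, (∀ d' < d,
SchonAt p d') → SchonAt p d`; `SchonAt p d` = every `d`-dimensional PRIME ideal `I ⊆ k[ℤ^N]`, `k = k̄`,
`char k = p`, admits `G₁..G_m ∉ I` with every initial degeneration `k[ℤ^(N+m)] ⧸ in_w⟨ι I, y_j − ι G_j⟩`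
regular).  cdisprove seat, cycle 1.  Kernel-checked load-bearing analysis of the two "anti-junk"
hypotheses of the typed statement (everything displayed inline, no definitions):

* `inductiveStep_no_prime_of_span_eq_top` — the mechanism of every junk witness: if the extended ideal
  `I' = ⟨generators⟩` is the unit ideal then EVERY initial ideal `in_w(I')` is the unit ideal
  (`in_w(1) = 1`, `inductiveStep_inForm_one`), the degenerations are the zero ring and carry no prime:
  the schön clause `∀ w P, IsRegularLocalRing _` holds vacuously.
* `inductiveStep_extIdeal_eq_top_of_mem` — if some `G_j ∈ I` then `I' = ⊤` (`y_j ∈ I'` is a Laurent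
  monomial, a unit): this is exactly what the guard `∀ j, G j ∉ I` excludes, and
  `inductiveStep_clause_without_notMem_guard` records that WITHOUT the guard the conclusion of `SchonAt`
  holds for every ideal whatsoever (witness `m = 1`, `G = 0`) — the guard is load-bearing against vacuity.
* `inductiveStep_extIdeal_eq_top_of_mul_mem` — if `ab ∈ I` then `G = (a, b)` gives `I' = ⊤`
  (`y₀y₁ ∈ I'`); for `a ∉ I`, `b ∉ I` the pair passes the guard, so for a NON-prime `I` the guard is
  defeated, whence
* `inductiveStep_iff_withoutIsPrime` — the crux with the hypothesis `I.IsPrime` DELETED (in the induction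
  hypothesis and in the conclusion alike) is EQUIVALENT to the crux: primality is not load-bearing for the
  truth value (non-prime ideals of the right dimension are junk-true, `⊤` is excluded by
  `ringKrullDim (k[ℤ^N] ⧸ ⊤) = ⊥ ≠ d`); it only keeps the junk witness away from the prime case.  In
  particular a disproof cannot come from a reducible or non-reduced `V(I)`, and a proof may assume
  primality for free.

ELABORATION NOTE (load-bearing for anyone citing the route decls): the route file elaborates its items
under `open scoped Classical`, so the `DecidablePred` instance hidden in `f.coeff.filter (fun v => …)` is
the classical one; a statement fragment elaborated WITHOUT `open scoped Classical` is propositionally but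
not definitionally equal to the route's (unification with `InductiveStep` then fails by `whnf` time-out,
and `Literature…Tropical.weightInitialIdeal_eq_span`'s `rfl` does not fire against the route term).
This file is therefore written under `open scoped Classical`, and its generic lemmas take the
`DecidablePred` instance as an explicit argument `dec` (so that they apply to either elaboration).

Companion file `NotInductiveStepIff.lean` (shape of a counterexample); full analysis in the crux workfile
`Cruxes/InductiveStep/Disproof.lean`.
-/

set_option linter.dupNamespace false -- mandated namespace of this single-conjunct summit

open Summit.ResolutionOfSingularities.ResolutionOfSingularities.Theses.TropicalLinks
open scoped Classical

namespace Summit.ResolutionOfSingularities.ResolutionOfSingularities.Theorems.InductiveStep.Negative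

/-- `in_w(1) = 1` for the route's inlined initial form (any weight): the constant `1 = x^0` is a single
term. [folklore] -/
theorem inductiveStep_inForm_one {k : Type} [Field k] {M : ℕ} (w : Fin M → ℤ)
    (dec : ∀ f : AddMonoidAlgebra k (Fin M → ℤ),
      DecidablePred fun v : Fin M → ℤ => ∀ u ∈ f.coeff.support, ∑ i, w i * v i ≤ ∑ i, w i * u i) :
    (fun f : AddMonoidAlgebra k (Fin M → ℤ) => AddMonoidAlgebra.ofCoeff (@Finsupp.filter (Fin M → ℤ) k _ (fun v => ∀ u ∈ f.coeff.support, ∑ i, w i * v i ≤ ∑ i, w i * u i) (dec f) f.coeff)) 1 = 1 := by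
  have h1 : (1 : AddMonoidAlgebra k (Fin M → ℤ)).coeff = Finsupp.single 0 1 := rfl
  beta_reduce
  have hf : ∀ x, (1 : AddMonoidAlgebra k (Fin M → ℤ)).coeff x ≠ 0 →
      ∀ u ∈ (1 : AddMonoidAlgebra k (Fin M → ℤ)).coeff.support, ∑ i, w i * x i ≤ ∑ i, w i * u i := by
    intro x hx u hu
    rw [h1, Finsupp.mem_support_iff] at hu
    rw [h1] at hx
    rw [(Finsupp.single_apply_ne_zero.1 hx).1, (Finsupp.single_apply_ne_zero.1 hu).1]
  rw [(Finsupp.filter_eq_self_iff _ _).mpr hf]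

/-- **No prime survives a unit extended ideal.** If `Ideal.span S = ⊤` in `k[ℤ^M]` then, for every
weight `w`, the initial ideal `in_w(Ideal.span S)` (the route's inlined term) contains `in_w(1) = 1`, so
the degeneration `k[ℤ^M] ⧸ in_w` is the zero ring and has no prime ideal. [folklore] -/
theorem inductiveStep_no_prime_of_span_eq_top {k : Type} [Field k] {M : ℕ}
    (S : Set (AddMonoidAlgebra k (Fin M → ℤ))) (hS : Ideal.span S = ⊤) (w : Fin M → ℤ)
    (dec : ∀ f : AddMonoidAlgebra k (Fin M → ℤ),
      DecidablePred fun v : Fin M → ℤ => ∀ u ∈ f.coeff.support, ∑ i, w i * v i ≤ ∑ i, w i * u i)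
    (P : Ideal (AddMonoidAlgebra k (Fin M → ℤ) ⧸ Ideal.span ((fun f : AddMonoidAlgebra k (Fin M → ℤ) => AddMonoidAlgebra.ofCoeff (@Finsupp.filter (Fin M → ℤ) k _ (fun v => ∀ u ∈ f.coeff.support, ∑ i, w i * v i ≤ ∑ i, w i * u i) (dec f) f.coeff)) '' (↑(Ideal.span S) : Set (AddMonoidAlgebra k (Fin M → ℤ))))))
    [hP : P.IsPrime] : False := by
  have h1 : (1 : AddMonoidAlgebra k (Fin M → ℤ)) ∈ (↑(Ideal.span S) : Set (AddMonoidAlgebra k (Fin M → ℤ))) := by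
    simp [hS]
  have hJ : Ideal.span ((fun f : AddMonoidAlgebra k (Fin M → ℤ) => AddMonoidAlgebra.ofCoeff (@Finsupp.filter (Fin M → ℤ) k _ (fun v => ∀ u ∈ f.coeff.support, ∑ i, w i * v i ≤ ∑ i, w i * u i) (dec f) f.coeff)) '' (↑(Ideal.span S) : Set (AddMonoidAlgebra k (Fin M → ℤ)))) = ⊤ :=
    Ideal.eq_top_of_isUnit_mem _ (Ideal.subset_span ⟨1, h1, inductiveStep_inForm_one w dec⟩) isUnit_one
  haveI := Ideal.Quotient.subsingleton_iff.mpr hJ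
  exact hP.ne_top (Subsingleton.elim _ _)

section ExtIdeal

variable {k : Type} [Field k] {N m : ℕ}

/-- The Laurent monomial `y_j` of the route is a unit of `k[ℤ^(N+m)]`. [folklore] -/
theorem inductiveStep_isUnit_yvar (j : Fin m) :
    IsUnit (AddMonoidAlgebra.single (Fin.append (0 : Fin N → ℤ) (Pi.single j (1 : ℤ))) (1 : k) :
      AddMonoidAlgebra k (Fin (N + m) → ℤ)) :=
  Literature.AlgebraicGeometry.Tropical.isUnit_single isUnit_one _

/-- **A `G_j ∈ I` collapses the extended ideal**: then `y_j − ι G_j ∈ I'` and `ι G_j ∈ I'`, so the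
unit `y_j` lies in `I' = ⟨ι I, y − ι G⟩`, i.e. `I' = ⊤`. [folklore] -/
theorem inductiveStep_extIdeal_eq_top_of_mem (I : Ideal (AddMonoidAlgebra k (Fin N → ℤ)))
    (G : Fin m → AddMonoidAlgebra k (Fin N → ℤ)) (j : Fin m) (hj : G j ∈ I) :
    Ideal.span ((fun f : AddMonoidAlgebra k (Fin N → ℤ) => (AddMonoidAlgebra.ofCoeff (f.coeff.mapDomain fun v => Fin.append v (0 : Fin m → ℤ)) : AddMonoidAlgebra k (Fin (N + m) → ℤ))) '' (↑I : Set (AddMonoidAlgebra k (Fin N → ℤ))) ∪ Set.range (fun j : Fin m => AddMonoidAlgebra.single (Fin.append (0 : Fin N → ℤ) (Pi.single j (1 : ℤ))) (1 : k) - AddMonoidAlgebra.ofCoeff ((G j).coeff.mapDomain fun v => Fin.append v (0 : Fin m → ℤ)))) = ⊤ := by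
  apply Ideal.eq_top_of_isUnit_mem _ ?_ (inductiveStep_isUnit_yvar (k := k) (N := N) j)
  have h1 : ((fun f : AddMonoidAlgebra k (Fin N → ℤ) => (AddMonoidAlgebra.ofCoeff (f.coeff.mapDomain fun v => Fin.append v (0 : Fin m → ℤ)) : AddMonoidAlgebra k (Fin (N + m) → ℤ))) (G j)) ∈ Ideal.span ((fun f : AddMonoidAlgebra k (Fin N → ℤ) => (AddMonoidAlgebra.ofCoeff (f.coeff.mapDomain fun v => Fin.append v (0 : Fin m → ℤ)) : AddMonoidAlgebra k (Fin (N + m) → ℤ))) '' (↑I : Set (AddMonoidAlgebra k (Fin N → ℤ))) ∪ Set.range (fun j : Fin m => AddMonoidAlgebra.single (Fin.append (0 : Fin N → ℤ) (Pi.single j (1 : ℤ))) (1 : k) - AddMonoidAlgebra.ofCoeff ((G j).coeff.mapDomain fun v => Fin.append v (0 : Fin m → ℤ)))) :=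
    Ideal.subset_span (Or.inl ⟨G j, hj, rfl⟩)
  have h2 := Ideal.subset_span (s := (fun f : AddMonoidAlgebra k (Fin N → ℤ) => (AddMonoidAlgebra.ofCoeff (f.coeff.mapDomain fun v => Fin.append v (0 : Fin m → ℤ)) : AddMonoidAlgebra k (Fin (N + m) → ℤ))) '' (↑I : Set (AddMonoidAlgebra k (Fin N → ℤ))) ∪ Set.range (fun j : Fin m => AddMonoidAlgebra.single (Fin.append (0 : Fin N → ℤ) (Pi.single j (1 : ℤ))) (1 : k) - AddMonoidAlgebra.ofCoeff ((G j).coeff.mapDomain fun v => Fin.append v (0 : Fin m → ℤ)))) (Or.inr ⟨j, rfl⟩)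
  simpa using Ideal.add_mem _ h2 h1

end ExtIdeal

/-- **Without the guard `∀ j, G j ∉ I` the conclusion of `SchonAt` is vacuous-true for EVERY ideal**
(any `k`, `N`, `I`; witness `m = 1`, `G = 0 ∈ I`): the displayed statement is the `∃ (m, G)`-clause of
the crux with the guard deleted. [folklore] -/
theorem inductiveStep_clause_without_notMem_guard {k : Type} [Field k] (N : ℕ)
    (I : Ideal (AddMonoidAlgebra k (Fin N → ℤ))) :
    ∃ (m : ℕ) (G : Fin m → AddMonoidAlgebra k (Fin N → ℤ)), ∀ (w : Fin (N + m) → ℤ) (P : Ideal (AddMonoidAlgebra k (Fin (N + m) → ℤ) ⧸ Ideal.span ((fun f : AddMonoidAlgebra k (Fin (N + m) → ℤ) => AddMonoidAlgebra.ofCoeff (f.coeff.filter fun v => ∀ u ∈ f.coeff.support, ∑ i, w i * v i ≤ ∑ i, w i * u i)) '' (↑(Ideal.span ((fun f : AddMonoidAlgebra k (Fin N → ℤ) => (AddMonoidAlgebra.ofCoeff (f.coeff.mapDomain fun v => Fin.append v (0 : Fin m → ℤ)) : AddMonoidAlgebra k (Fin (N + m) → ℤ))) '' (↑I : Set (AddMonoidAlgebra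 k (Fin N → ℤ))) ∪ Set.range (fun j : Fin m => AddMonoidAlgebra.single (Fin.append (0 : Fin N → ℤ) (Pi.single j (1 : ℤ))) (1 : k) - AddMonoidAlgebra.ofCoeff ((G j).coeff.mapDomain fun v => Fin.append v (0 : Fin m → ℤ))))) : Set (AddMonoidAlgebra k (Fin (N + m) → ℤ)))))) [P.IsPrime], IsRegularLocalRing (Localization.AtPrime P) := by
  refine ⟨1, fun _ => 0, ?_⟩
  intro w P hP
  exact (inductiveStep_no_prime_of_span_eq_top _
    (inductiveStep_extIdeal_eq_top_of_mem I (fun _ : Fin 1 => 0) 0 I.zero_mem) w _ P).elim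

section MulMem

variable {k : Type} [Field k] {N : ℕ}

/-- The lattice embedding `ℤ^N → ℤ^(N+m)`, `v ↦ (v, 0)`, is additive. [folklore] -/
theorem inductiveStep_append_zero_add (m : ℕ) (u v : Fin N → ℤ) :
    Fin.append (u + v) (0 : Fin m → ℤ) = Fin.append u 0 + Fin.append v 0 := by
  funext i
  refine Fin.addCases (fun i => ?_) (fun i => ?_) i <;> simp

/-- The route's `ι = k[v ↦ (v, 0)] : k[ℤ^N] → k[ℤ^(N+2)]` is multiplicative (it is
`AddMonoidAlgebra.mapDomain` of an additive map). [folklore] -/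
theorem inductiveStep_iota_mul (a b : AddMonoidAlgebra k (Fin N → ℤ)) :
    (fun f : AddMonoidAlgebra k (Fin N → ℤ) => (AddMonoidAlgebra.ofCoeff (f.coeff.mapDomain fun v => Fin.append v (0 : Fin 2 → ℤ)) : AddMonoidAlgebra k (Fin (N + 2) → ℤ))) (a * b) = (fun f : AddMonoidAlgebra k (Fin N → ℤ) => (AddMonoidAlgebra.ofCoeff (f.coeff.mapDomain fun v => Fin.append v (0 : Fin 2 → ℤ)) : AddMonoidAlgebra k (Fin (N + 2) → ℤ))) a * (fun f : AddMonoidAlgebra k (Fin N → ℤ) => (AddMonoidAlgebra.ofCoeff (f.coeff.mapDomain fun v => Fin.append v (0 : Fin 2 → ℤ)) : AddMonoidAlgebra k (Fin (N + 2) → ℤ))) b :=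
  AddMonoidAlgebra.mapDomain_mul
    ({ toFun := fun v => Fin.append v 0
       map_zero' := by simpa using inductiveStep_append_zero_add (N := N) 2 0 0
       map_add' := inductiveStep_append_zero_add 2 } : (Fin N → ℤ) →+ (Fin (N + 2) → ℤ)) a b

set_option maxHeartbeats 800000 in
/-- **A zero-divisor pair modulo `I` defeats the guard**: if `ab ∈ I`, the pair `G = (a, b)` gives
`I' = ⟨ι I, y₀ − ι a, y₁ − ι b⟩ = ⊤`, because `y₀ y₁ = (y₀ − ι a) y₁ + ι a (y₁ − ι b) + ι(ab) ∈ I'` is a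
unit; when `a ∉ I`, `b ∉ I` the pair passes the guard `∀ j, G j ∉ I`. (Displayed: the route's extended
ideal at `m = 2`, `G = ![a, b]`.) [folklore] -/
theorem inductiveStep_extIdeal_eq_top_of_mul_mem (I : Ideal (AddMonoidAlgebra k (Fin N → ℤ)))
    (a b : AddMonoidAlgebra k (Fin N → ℤ)) (hab : a * b ∈ I) :
    Ideal.span ((fun f : AddMonoidAlgebra k (Fin N → ℤ) => (AddMonoidAlgebra.ofCoeff (f.coeff.mapDomain fun v => Fin.append v (0 : Fin 2 → ℤ)) : AddMonoidAlgebra k (Fin (N + 2) → ℤ))) '' (↑I : Set (AddMonoidAlgebra k (Fin N → ℤ))) ∪ Set.range (fun j : Fin 2 => AddMonoidAlgebra.single (Fin.append (0 : Fin N → ℤ) (Pi.single j (1 : ℤ))) (1 : k) - AddMonoidAlgebra.ofCoeff ((![a, b] j).coeff.mapDomain fun v => Fin.append v (0 : Fin 2 → ℤ)))) = ⊤ := by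
  have h1 : (fun f : AddMonoidAlgebra k (Fin N → ℤ) => (AddMonoidAlgebra.ofCoeff (f.coeff.mapDomain fun v => Fin.append v (0 : Fin 2 → ℤ)) : AddMonoidAlgebra k (Fin (N + 2) → ℤ))) (a * b) ∈ Ideal.span ((fun f : AddMonoidAlgebra k (Fin N → ℤ) => (AddMonoidAlgebra.ofCoeff (f.coeff.mapDomain fun v => Fin.append v (0 : Fin 2 → ℤ)) : AddMonoidAlgebra k (Fin (N + 2) → ℤ))) '' (↑I : Set (AddMonoidAlgebra k (Fin N → ℤ))) ∪ Set.range (fun j : Fin 2 => AddMonoidAlgebra.single (Fin.append (0 : Fin N → ℤ) (Pi.single j (1 : ℤ))) (1 : k) - AddMonoidAlgebra.ofCoeff ((![a, b] j).coeff.mapDomain fun v => Fin.append v (0 : Fin 2 → ℤ)))) := Ideal.subset_span (Or.inl ⟨a * b, hab, rfl⟩)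
  have h2 := Ideal.subset_span (s := (fun f : AddMonoidAlgebra k (Fin N → ℤ) => (AddMonoidAlgebra.ofCoeff (f.coeff.mapDomain fun v => Fin.append v (0 : Fin 2 → ℤ)) : AddMonoidAlgebra k (Fin (N + 2) → ℤ))) '' (↑I : Set (AddMonoidAlgebra k (Fin N → ℤ))) ∪ Set.range (fun j : Fin 2 => AddMonoidAlgebra.single (Fin.append (0 : Fin N → ℤ) (Pi.single j (1 : ℤ))) (1 : k) - AddMonoidAlgebra.ofCoeff ((![a, b] j).coeff.mapDomain fun v => Fin.append v (0 : Fin 2 → ℤ)))) (Or.inr ⟨(0 : Fin 2), rfl⟩)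
  have h3 := Ideal.subset_span (s := (fun f : AddMonoidAlgebra k (Fin N → ℤ) => (AddMonoidAlgebra.ofCoeff (f.coeff.mapDomain fun v => Fin.append v (0 : Fin 2 → ℤ)) : AddMonoidAlgebra k (Fin (N + 2) → ℤ))) '' (↑I : Set (AddMonoidAlgebra k (Fin N → ℤ))) ∪ Set.range (fun j : Fin 2 => AddMonoidAlgebra.single (Fin.append (0 : Fin N → ℤ) (Pi.single j (1 : ℤ))) (1 : k) - AddMonoidAlgebra.ofCoeff ((![a, b] j).coeff.mapDomain fun v => Fin.append v (0 : Fin 2 → ℤ)))) (Or.inr ⟨(1 : Fin 2), rfl⟩)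
  rw [inductiveStep_iota_mul] at h1
  have hu := (inductiveStep_isUnit_yvar (k := k) (N := N) (0 : Fin 2)).mul
    (inductiveStep_isUnit_yvar (k := k) (N := N) (1 : Fin 2))
  refine Ideal.eq_top_of_isUnit_mem _ ?_ hu
  have key := Ideal.add_mem _ (Ideal.add_mem _ (Ideal.mul_mem_right
    (AddMonoidAlgebra.single (Fin.append (0 : Fin N → ℤ) (Pi.single (1 : Fin 2) (1 : ℤ))) (1 : k)) _
    h2) (Ideal.mul_mem_left _ ((fun f : AddMonoidAlgebra k (Fin N → ℤ) => (AddMonoidAlgebra.ofCoeff (f.coeff.mapDomain fun v => Fin.append v (0 : Fin 2 → ℤ)) : AddMonoidAlgebra k (Fin (N + 2) → ℤ))) a) h3)) h1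
  convert key using 1
  simp only [Matrix.cons_val_zero, Matrix.cons_val_one]
  ring

end MulMem

/-- `SchonAt` WITHOUT the primality hypothesis implies `SchonAt` (weakening). [folklore] -/
theorem inductiveStep_schonAt_of_withoutIsPrime (p d : ℕ)
    (h : ∀ (k : Type) [Field k] [CharP k p] [IsAlgClosed k] (N : ℕ) (I : Ideal (AddMonoidAlgebra k (Fin N → ℤ))), ringKrullDim (AddMonoidAlgebra k (Fin N → ℤ) ⧸ I) = (d : WithBot ℕ∞) → ∃ (m : ℕ) (G : Fin m → AddMonoidAlgebra k (Fin N → ℤ)), (∀ j, G j ∉ I) ∧ ∀ (w : Fin (N + m) → ℤ) (P : Ideal (AddMonoidAlgebra k (Fin (N + m) → ℤ) ⧸ Ideal.span ((fun f : AddMonoidAlgebra k (Fin (N + m) → ℤ) => AddMonoidAlgebra.ofCoeff (f.coeff.filter fun v => ∀ u ∈ f.coeff.support, ∑ i, w i * v i ≤ ∑ i, w i * u i)) '' (↑(Ideal.span ((fun f : AddMonoidAlgebra k (Fin N → ℤ) => (AddMonoidAlgebra.ofCoeff (f.coeff.mapDomain fun v => Fin.append v (0 : Fin m → ℤ)) :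 AddMonoidAlgebra k (Fin (N + m) → ℤ))) '' (↑I : Set (AddMonoidAlgebra k (Fin N → ℤ))) ∪ Set.range (fun j : Fin m => AddMonoidAlgebra.single (Fin.append (0 : Fin N → ℤ) (Pi.single j (1 : ℤ))) (1 : k) - AddMonoidAlgebra.ofCoeff ((G j).coeff.mapDomain fun v => Fin.append v (0 : Fin m → ℤ))))) : Set (AddMonoidAlgebra k (Fin (N + m) → ℤ)))))) [P.IsPrime], IsRegularLocalRing (Localization.AtPrime P)) :
    ∀ (k : Type) [Field k] [CharP k p] [IsAlgClosed k] (N : ℕ) (I : Ideal (AddMonoidAlgebra k (Fin N → ℤ))), I.IsPrime → ringKrullDim (AddMonoidAlgebra k (Fin N → ℤ) ⧸ I) = (d : WithBot ℕ∞) → ∃ (m : ℕ) (G : Fin m → AddMonoidAlgebra k (Fin N → ℤ)), (∀ j, G j ∉ I) ∧ ∀ (w : Fin (N + m) → ℤ) (P : Ideal (AddMonoidAlgebra k (Fin (N + m) → ℤ) ⧸ Ideal.span ((fun f : AddMonoidAlgebra k (Fin (N + m) → ℤ) => AddMonoidAlgebra.ofCoeff (f.coeff.filter fun v => ∀ u ∈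 f.coeff.support, ∑ i, w i * v i ≤ ∑ i, w i * u i)) '' (↑(Ideal.span ((fun f : AddMonoidAlgebra k (Fin N → ℤ) => (AddMonoidAlgebra.ofCoeff (f.coeff.mapDomain fun v => Fin.append v (0 : Fin m → ℤ)) : AddMonoidAlgebra k (Fin (N + m) → ℤ))) '' (↑I : Set (AddMonoidAlgebra k (Fin N → ℤ))) ∪ Set.range (fun j : Fin m => AddMonoidAlgebra.single (Fin.append (0 : Fin N → ℤ) (Pi.single j (1 : ℤ))) (1 : k) - AddMonoidAlgebra.ofCoeff ((G j).coeff.mapDomain fun v => Fin.append v (0 : Fin m → ℤ))))) : Set (AddMonoidAlgebra k (Fin (N + m) → ℤ)))))) [P.IsPrime], IsRegularLocalRing (Localization.AtPrime P) := by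
  intro k _ _ _ N I _ hdim
  exact h k N I hdim

/-- `SchonAt` implies `SchonAt` WITHOUT the primality hypothesis: a non-prime `I` of dimension `d` is
junk-true (`I = ⊤` is excluded by `ringKrullDim (k[ℤ^N] ⧸ ⊤) = ⊥`; otherwise a zero-divisor pair is a
guard-passing witness, `inductiveStep_extIdeal_eq_top_of_mul_mem`). [folklore] -/
theorem inductiveStep_withoutIsPrime_of_schonAt (p d : ℕ)
    (h : ∀ (k : Type) [Field k] [CharP k p] [IsAlgClosed k] (N : ℕ) (I : Ideal (AddMonoidAlgebra k (Fin N → ℤ))), I.IsPrime → ringKrullDim (AddMonoidAlgebra k (Fin N → ℤ) ⧸ I) = (d : WithBot ℕ∞) → ∃ (m : ℕ) (G : Fin m → AddMonoidAlgebra k (Fin N → ℤ)), (∀ j, G j ∉ I) ∧ ∀ (w : Fin (N + m) → ℤ) (P : Ideal (AddMonoidAlgebra k (Fin (N + m) → ℤ) ⧸ Ideal.span ((fun f : AddMonoidAlgebra k (Fin (N + m) → ℤ) => AddMonoidAlgebra.ofCoeff (f.coeff.filter fun v => ∀ u ∈ f.coeff.support, ∑ i, w i * v i ≤ ∑ i,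 w i * u i)) '' (↑(Ideal.span ((fun f : AddMonoidAlgebra k (Fin N → ℤ) => (AddMonoidAlgebra.ofCoeff (f.coeff.mapDomain fun v => Fin.append v (0 : Fin m → ℤ)) : AddMonoidAlgebra k (Fin (N + m) → ℤ))) '' (↑I : Set (AddMonoidAlgebra k (Fin N → ℤ))) ∪ Set.range (fun j : Fin m => AddMonoidAlgebra.single (Fin.append (0 : Fin N → ℤ) (Pi.single j (1 : ℤ))) (1 : k) - AddMonoidAlgebra.ofCoeff ((G j).coeff.mapDomain fun v => Fin.append v (0 : Fin m → ℤ))))) : Set (AddMonoidAlgebra k (Fin (N + m) → ℤ)))))) [P.IsPrime], IsRegularLocalRing (Localization.AtPrime P)) :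
    ∀ (k : Type) [Field k] [CharP k p] [IsAlgClosed k] (N : ℕ) (I : Ideal (AddMonoidAlgebra k (Fin N → ℤ))), ringKrullDim (AddMonoidAlgebra k (Fin N → ℤ) ⧸ I) = (d : WithBot ℕ∞) → ∃ (m : ℕ) (G : Fin m → AddMonoidAlgebra k (Fin N → ℤ)), (∀ j, G j ∉ I) ∧ ∀ (w : Fin (N + m) → ℤ) (P : Ideal (AddMonoidAlgebra k (Fin (N + m) → ℤ) ⧸ Ideal.span ((fun f : AddMonoidAlgebra k (Fin (N + m) → ℤ) => AddMonoidAlgebra.ofCoeff (f.coeff.filter fun v => ∀ u ∈ f.coeff.support, ∑ i, w i * v i ≤ ∑ i, w i * u i)) '' (↑(Ideal.span ((fun f : AddMonoidAlgebra k (Fin N → ℤ) => (AddMonoidAlgebra.ofCoeff (f.coeff.mapDomain fun v => Fin.append v (0 : Fin m → ℤ)) : AddMonoidAlgebra k (Fin (N + m) → ℤ))) '' (↑I : Set (AddMonoidAlgebra k (Fin N → ℤ))) ∪ Set.range (fun j : Fin m => AddMonoidAlgebra.single (Fin.append (0 : Fin N → ℤ) (Pi.single j (1 : ℤ))) (1 :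 k) - AddMonoidAlgebra.ofCoeff ((G j).coeff.mapDomain fun v => Fin.append v (0 : Fin m → ℤ))))) : Set (AddMonoidAlgebra k (Fin (N + m) → ℤ)))))) [P.IsPrime], IsRegularLocalRing (Localization.AtPrime P) := by
  intro k _ _ _ N I hdim
  by_cases hI : I.IsPrime
  · exact h k N I hI hdim
  · rcases Ideal.not_isPrime_iff.1 hI with htop | ⟨a, ha, b, hb, hab⟩
    · exfalso
      subst htop
      haveI : Subsingleton (AddMonoidAlgebra k (Fin N → ℤ) ⧸ (⊤ : Ideal (AddMonoidAlgebra k (Fin N → ℤ)))) :=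
        Ideal.Quotient.subsingleton_iff.mpr rfl
      rw [ringKrullDim_eq_bot_of_subsingleton] at hdim
      exact WithBot.bot_ne_coe hdim
    · refine ⟨2, ![a, b], ?_, ?_⟩
      · intro j
        fin_cases j
        · exact ha
        · exact hb
      · intro w P hP
        exact (inductiveStep_no_prime_of_span_eq_top _
          (inductiveStep_extIdeal_eq_top_of_mul_mem I a b hab) w _ P).elim

/-- **`I.IsPrime` is not load-bearing for the truth value of the crux.** The displayed statement is
`TropicalLinks.InductiveStep` with the hypothesis `I.IsPrime →` DELETED at both of its occurrences
(induction hypothesis and conclusion), everything else verbatim; it is EQUIVALENT to the crux: for a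
non-prime `I ≠ ⊤` a zero-divisor pair `(a, b)` is a guard-passing junk witness
(`inductiveStep_extIdeal_eq_top_of_mul_mem`), and `I = ⊤` is excluded by the dimension hypothesis
(`ringKrullDim` of the zero ring is `⊥`). So no refutation can use a reducible or non-reduced `V(I)`,
and a prover loses nothing by assuming primality. [folklore] -/
theorem inductiveStep_iff_withoutIsPrime :
    InductiveStep ↔ (∀ p : ℕ, p.Prime → ∀ d : ℕ, (∀ d' < d, (fun (p d : ℕ) => ∀ (k : Type) [Field k] [CharP k p] [IsAlgClosed k] (N : ℕ) (I : Ideal (AddMonoidAlgebra k (Fin N → ℤ))), ringKrullDim (AddMonoidAlgebra k (Fin N → ℤ) ⧸ I) = (d : WithBot ℕ∞) → ∃ (m : ℕ) (G : Fin m → AddMonoidAlgebra k (Fin N → ℤ)), (∀ j, G j ∉ I) ∧ ∀ (w : Fin (N + m) → ℤ) (P : Ideal (AddMonoidAlgebra k (Fin (N + m) → ℤ) ⧸ Ideal.span ((fun f : AddMonoidAlgebra k (Fin (N + m) → ℤ) => AddMonoidAlgebra.ofCoeff (f.coeff.filter fun v => ∀ u ∈ f.coeff.support, ∑ i, w i *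 v i ≤ ∑ i, w i * u i)) '' (↑(Ideal.span ((fun f : AddMonoidAlgebra k (Fin N → ℤ) => (AddMonoidAlgebra.ofCoeff (f.coeff.mapDomain fun v => Fin.append v (0 : Fin m → ℤ)) : AddMonoidAlgebra k (Fin (N + m) → ℤ))) '' (↑I : Set (AddMonoidAlgebra k (Fin N → ℤ))) ∪ Set.range (fun j : Fin m => AddMonoidAlgebra.single (Fin.append (0 : Fin N → ℤ) (Pi.single j (1 : ℤ))) (1 : k) - AddMonoidAlgebra.ofCoeff ((G j).coeff.mapDomain fun v => Fin.append v (0 : Fin m → ℤ))))) : Set (AddMonoidAlgebra k (Fin (N + m) → ℤ)))))) [P.IsPrime], IsRegularLocalRing (Localization.AtPrime P)) p d') → (fun (p d : ℕ) => ∀ (k : Type) [Field k] [CharP k p] [IsAlgClosed k] (N : ℕ) (I : Ideal (AddMonoidAlgebra k (Fin N → ℤ))), ringKrullDim (AddMonoidAlgebra k (Fin N → ℤ) ⧸ I) = (d : WithBot ℕ∞) → ∃ (m : ℕ) (G : Fin m → AddMonoidAlgebra k (Fin N → ℤ)), (∀ j, G j ∉ I) ∧ ∀ (w : Fin (N + m)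 → ℤ) (P : Ideal (AddMonoidAlgebra k (Fin (N + m) → ℤ) ⧸ Ideal.span ((fun f : AddMonoidAlgebra k (Fin (N + m) → ℤ) => AddMonoidAlgebra.ofCoeff (f.coeff.filter fun v => ∀ u ∈ f.coeff.support, ∑ i, w i * v i ≤ ∑ i, w i * u i)) '' (↑(Ideal.span ((fun f : AddMonoidAlgebra k (Fin N → ℤ) => (AddMonoidAlgebra.ofCoeff (f.coeff.mapDomain fun v => Fin.append v (0 : Fin m → ℤ)) : AddMonoidAlgebra k (Fin (N + m) → ℤ))) '' (↑I : Set (AddMonoidAlgebra k (Fin N → ℤ))) ∪ Set.range (fun j : Fin m => AddMonoidAlgebra.single (Fin.append (0 : Fin N → ℤ) (Pi.single j (1 : ℤ))) (1 : k) - AddMonoidAlgebra.ofCoeff ((G j).coeff.mapDomain fun v => Fin.append v (0 : Fin m → ℤ))))) : Set (AddMonoidAlgebra k (Fin (N + m) → ℤ)))))) [P.IsPrime], IsRegularLocalRing (Localization.AtPrime P)) p d) := by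
  constructor
  · intro h p hp d ih
    exact inductiveStep_withoutIsPrime_of_schonAt p d
      (h p hp d fun d' hd' => inductiveStep_schonAt_of_withoutIsPrime p d' (ih d' hd'))
  · intro h p hp d _
    exact inductiveStep_schonAt_of_withoutIsPrime p d
      (Nat.strong_induction_on d fun d ih => h p hp d ih)

end Summit.ResolutionOfSingularities.ResolutionOfSingularities.Theorems.InductiveStep.Negative
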